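import Literature.AlgebraicGeometry.Frobenioids.Thm34Sub
import Literature.AlgebraicGeometry.Frobenioids.EquivalenceGroupLikeQuasiIsotropic
import HarnessLib

/-!
# Frobenioids I, Theorem 3.4 sub-DAG: closers of `Thm34Sub` slots, tranche 4 — slot (iii)/L01g

Mochizuki, *The geometry of Frobenioids I: the general theory*, Kyushu J. Math. **62** (2008),
Thm. 3.4 (iii) p. 62, hypothesis (b) of "standard type" p. 62, proof p. 64
[cite: MochizukiFrdI2008, Thm. 3.4 (iii) p.62].

PROOF-ONLY file (abc-iut-w4-d088, holder of the sub-DAG row `FrdI:Thm3.4(iii)/L01g GroupLikeTypeCase` of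
`plan/L1/SUBDAG-FrdI-Thm34.md`; tranche 4 of the `Thm34Sub` closers, a NEW file next to abc-iut-L1-d8's
tranches 1–3 `Thm34SubClosers{,2,3}.lean`, which are left untouched). It closes the slot
`FrdI.Thm34Sub.L01g_GroupLikeTypeCase` (abc-iut-L1-d8, `Thm34Sub.lean` p412196) by the theorem
`FrdI.l01g_groupLikeTypeCase` (abc-iut-w4-d088, `EquivalenceGroupLikeQuasiIsotropic.lean` p412406, whose statement
is the slot's body verbatim): for Frobenioids `C₁, C₂` of group-like and quasi-isotropic type whose equivalence
`Ψ` and quasi-inverse `Ψ⁻¹` preserve base-isomorphisms (hypothesis (b)), `Ψ` preserves morphisms of Frobenius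
type, linear and co-angular morphisms, pull-back morphisms, isometries and LB-invertible morphisms, and Frobenius
degrees are carried by an automorphism `Ψ^{ℕ_{≥1}}` of `ℕ_{≥1}` (prime-Frobenius morphisms = irreducible
base-isomorphisms in group-like isotropic type, Prop. 1.14 (i); quasi-isotropic upgrade through `Ψ^istr`,
Thm. 3.4 (i)). The slot's FSM-type hypotheses on `D₁, D₂` are accepted and unused. Nothing is restated; no
statement of the paper is strengthened.
-/

namespace Literature.AlgebraicGeometry.Frobenioids

namespace FrdI

namespace Thm34Sub

open CategoryTheory PreFrobenioidData

universe w v v' u u'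

variable {D₁ : Type u} [Category.{v} D₁] {Φ₁ : D₁ᵒᵖ ⥤ CommMonCat.{w}} {C₁ : Type u'} [Category.{v'} C₁]
  {D₂ : Type u} [Category.{v} D₂] {Φ₂ : D₂ᵒᵖ ⥤ CommMonCat.{w}} {C₂ : Type u'} [Category.{v'} C₂]
  (F₁ : C₁ ⥤ ElemFrobenioid Φ₁) (F₂ : C₂ ⥤ ElemFrobenioid Φ₂) (Ψ : C₁ ≌ C₂)

/-- **SLOT (iii)/L01g `GroupLikeTypeCase` — CLOSED**: for Frobenioids `C₁ → F_{Φ₁}`, `C₂ → F_{Φ₂}` of group-like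
and quasi-isotropic type (over FSM-type bases — accepted, unused) and an equivalence `Ψ : C₁ ≌ C₂` such that `Ψ`
and `Ψ⁻¹` preserve base-isomorphisms (hypothesis (b) of standard type), `Ψ` preserves morphisms of Frobenius type,
linear morphisms, co-angular morphisms, pull-back morphisms, isometries and LB-invertible morphisms, and there is
an automorphism `Ψ^{ℕ_{≥1}}` of `ℕ_{≥1}` with `deg_Fr(Ψ(φ)) = Ψ^{ℕ_{≥1}}(deg_Fr(φ))` (abc-iut-w4-d088
`FrdI.l01g_groupLikeTypeCase`, p412406). [cite: MochizukiFrdI2008, Thm. 3.4 (iii) p.62] -/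
theorem l01g_groupLikeTypeCase_holds :
    Literature.AlgebraicGeometry.Frobenioids.FrdI.Thm34Sub.L01g_GroupLikeTypeCase F₁ F₂ Ψ :=
  fun hF₁ hF₂ hg₁ hg₂ hq₁ hq₂ hD₁ hD₂ hB hB' =>
    FrdI.l01g_groupLikeTypeCase Ψ hF₁ hF₂ hg₁ hg₂ hq₁ hq₂ hD₁ hD₂ hB hB'

end Thm34Sub

end FrdI

end Literature.AlgebraicGeometry.Frobenioids
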